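import Summits.HubbardSuperconductivity.HubbardSuperconductivity.Theorems.KLProgrammeKLRegimeScaleZeroWeightedSizes
import Summits.HubbardSuperconductivity.HubbardSuperconductivity.Theorems.KLProgrammeKLRegimeScaleZeroLatticeSumNumeral

/-!
# Route `KLProgramme`, crux K3 — engine-flow child (stmt-HubbardSuperconductivity-20437), stub (C) at `n = 0`, located brick «A-SIZES-WEIGHTED» (pen (R181)),
# brick 4f (ii): A PURE NUMERAL for the weighted sizes — `a_k(1) ≤ 10⁹⁵` (`k ≤ 4`), hence `hrow/hcol` with `a = 10⁹⁵` under the engine's binders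

Cell gate-hubbard-kl, seat p1 g21.  Crude termwise majorants of the closed form of brick 4e at the decay-length knob `ℓ = 1` (every `λ ∈ [0,1]`):
`klChi2CauchyTab n ≤ 4·10²⁷` (`n ≤ 14`), factorials `≤ 15!`, `S_m ≤ 9` (brick 4f (i)), `1/π ≤ 1`, `(π/e₀)^{k+2} ≤ 101⁶`, `max ≤ sum`; the resulting integer
majorant is `< 10⁹³`.  **`rowSum_scaleZero_weighted_le_numeral`** / **`colSum_scaleZero_weighted_le_numeral`**:
`Σ_Y ‖C X Y‖·wt_{λ,k}{X,Y} ≤ 10⁹⁵·(2(2M))/β` for `μ ∈ klWindowC`, `klBetaMin ≤ β`, `klEngL₃ β U ≤ L`, `klEngM₃ β U L ≤ M`, `k ≤ 4`, `0 ≤ λ ≤ 1`.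

Honest size: `10⁹⁵` is an analytic majorant some 80–90 orders above the true moments; it is what the booking door `klTailBookU` must absorb (STATUS p1 g21 13:1xZ).
Proofs only; no definitions; nothing here asserts (C), any stub of 20437, K3 or superconductivity.
References: BGM 2006 §2.4 (2.77)–(2.80) [cite: BenfattoGiulianiMastropietro2006].
-/

noncomputable section

namespace Summit.HubbardSuperconductivity.HubbardSuperconductivity.Theorems.KLRegimeSplit

set_option linter.dupNamespace false -- summit = problem name (single-conjunct summit), D-0017

open Literature.MathematicalPhysics.QuantumLattice Literature.Probability.LatticeModels Literature.Analysis.FunctionSpaces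
open Literature.Probability.LatticeModels.BattleFederbush
open Summit.HubbardSuperconductivity.HubbardSuperconductivity.Theorems.DispersionFlow
open Summit.HubbardSuperconductivity.HubbardSuperconductivity.Theorems.EngineV8 (gridLabelDist gridLegPos klEngL₃)
open Finset Real
open scoped Nat

variable {L M : ℕ} [NeZero L] [NeZero M]

omit [NeZero L] [NeZero M] in
/-- The cutoff table up to order `14` is at most `4·10²⁷`. -/
theorem klChi2CauchyTab_le_of_le_fourteen {n : ℕ} (hn : n ≤ 14) : klChi2CauchyTab n ≤ 4 * 10 ^ 27 := by
  interval_cases n <;> simp only [klChi2CauchyTab] <;> norm_num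

omit [NeZero L] [NeZero M] in
/-- **THE NUMERAL**: at `ℓ = 1` and `k ≤ 4` the constant `a_k(1)` of `rowSum_scaleZero_weighted_le_size` is at most `10⁹⁵`. -/
theorem weightedSize_le_numeral {k : ℕ} (hk : k ≤ 4) :
    let Aon : ℕ → ℝ := fun i => klChi2CauchyTab (k + 2) * (i + 1) ! * 2 ^ (i + 1)
    let Aoff : ℕ → ℝ := fun i => (k + 4) ! * klChi2CauchyTab (i + (k + 4)) * (i + (k + 4) + 1) ! * 2 ^ (i + 2) * (2 / klE0) *
      (max 1 (4 / klE0)) ^ (k + 4 - 1) * 8 ^ (k + 4) * (1 + (4 : ℝ) ^ (k + 4) * ∑' q : Site 2, ((1 + ‖q‖) ^ (k + 4))⁻¹)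
    let Goff : ℝ := 4 * ((k + 4) ! * klChi2CauchyTab (k + 4) * (k + 4 + 1) ! * (max 1 (4 / klE0)) ^ (k + 4 - 1) * 8 ^ (k + 4) *
      (1 + (4 : ℝ) ^ (k + 4) * ∑' q : Site 2, ((1 + ‖q‖) ^ (k + 4))⁻¹)) * (2 / klE0)
    let EDon : ℝ := ∑ i ∈ Finset.range (k + 2), 2 * ((max i 1 : ℕ) : ℝ) * 2 ^ i * Aon i / π
    let EDoff : ℝ := ∑ i ∈ Finset.range (k + 2), 2 * ((max i 1 : ℕ) : ℝ) * 2 ^ i * Aoff i / π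
    let Gon' : ℝ := max 16 ((k + 2 : ℕ) * Aon (k + 2) * (π / klE0) ^ (k + 2) / (1 : ℝ) ^ (k + 2)) * 2 ^ (k + 2)
    let Goff' : ℝ := max Goff ((k + 2 : ℕ) * Aoff (k + 2) * (π / klE0) ^ (k + 2) / (1 : ℝ) ^ (k + 2)) * 2 ^ (k + 2)
    let a : ℝ := (EDon + EDoff * ∑' z : Site 2, ((1 + ‖z‖) ^ 4)⁻¹) + 2 * (1 + (1 : ℝ)) * (Gon' + Goff' * ∑' z : Site 2, ((1 + ‖z‖) ^ 4)⁻¹)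
    a ≤ (10 : ℝ) ^ 95 := by
  intro Aon Aoff Goff EDon EDoff Gon' Goff' a
  -- the crude majorants
  set T : ℝ := 4 * 10 ^ 27 with hT
  set CA : ℝ := T * (7 ! : ℕ) * 2 ^ 7 with hCA
  set CB : ℝ := (8 ! : ℕ) * T * (15 ! : ℕ) * 2 ^ 8 * 64 * 128 ^ 7 * 8 ^ 8 * (1 + 4 ^ 8 * 9) with hCB
  set CG : ℝ := 4 * ((8 ! : ℕ) * T * (9 ! : ℕ) * 128 ^ 7 * 8 ^ 8 * (1 + 4 ^ 8 * 9)) * 64 with hCG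
  have hE0 : klE0 = 1 / 32 := rfl
  have hS : ∀ m, 4 ≤ m → ∑' q : Site 2, ((1 + ‖q‖) ^ m)⁻¹ ≤ 9 := fun m hm => tsum_inv_one_add_norm_pow_le_nine hm
  have hS0 : ∀ m : ℕ, 0 ≤ ∑' q : Site 2, ((1 + ‖q‖) ^ m)⁻¹ := fun m => tsum_nonneg fun _ => by positivity
  have hTle : ∀ n ≤ 14, klChi2CauchyTab n ≤ T := fun n hn => by rw [hT]; exact klChi2CauchyTab_le_of_le_fourteen hn
  have hT0 : ∀ n, 0 ≤ klChi2CauchyTab n := fun n => zero_le_one.trans (one_le_klChi2CauchyTab n)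
  have hfac : ∀ a b : ℕ, a ≤ b → ((a ! : ℕ) : ℝ) ≤ ((b ! : ℕ) : ℝ) := fun a b h => by exact_mod_cast Nat.factorial_le h
  have hp2 : ∀ a b : ℕ, a ≤ b → (2 : ℝ) ^ a ≤ 2 ^ b := fun a b h => pow_le_pow_right₀ (by norm_num) h
  have hmax128 : max 1 (4 / klE0) = 128 := by rw [hE0]; norm_num
  have h2e : (2 : ℝ) / klE0 = 64 := by rw [hE0]; norm_num
  have hπe : π / klE0 ≤ 101 := by rw [hE0]; have := Real.pi_lt_d2; rw [div_le_iff₀ (by norm_num)]; linarith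
  have hπe0 : 0 ≤ π / klE0 := by rw [hE0]; positivity
  have hπpow : (π / klE0) ^ (k + 2) ≤ 101 ^ 6 :=
    (pow_le_pow_left₀ hπe0 hπe _).trans (pow_le_pow_right₀ (by norm_num) (by omega))
  have h2k : (2 : ℝ) ^ (k + 2) ≤ 64 := (hp2 _ 6 (by omega)).trans (by norm_num)
  have hk6 : ((k + 2 : ℕ) : ℝ) ≤ 6 := by exact_mod_cast (show k + 2 ≤ 6 by omega)
  -- Aon, Aoff, Goff against the crude constants
  have hAon : ∀ i ≤ 6, Aon i ≤ CA := by
    intro i hi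
    simp only [Aon, hCA]
    have h1 := hTle (k + 2) (by omega)
    have h2 := hfac (i + 1) 7 (by omega)
    have h3 := hp2 (i + 1) 7 (by omega)
    have := hT0 (k + 2)
    exact mul_le_mul (mul_le_mul h1 h2 (by positivity) (by rw [hT]; norm_num)) h3 (by positivity) (by positivity)
  have hAon0 : ∀ i, 0 ≤ Aon i := fun i => by simp only [Aon]; have := hT0 (k + 2); positivity
  have hSk := hS (k + 4) (by omega)
  have hSk0 := hS0 (k + 4)
  have hbr : (1 + (4 : ℝ) ^ (k + 4) * ∑' q : Site 2, ((1 + ‖q‖) ^ (k + 4))⁻¹) ≤ 1 + 4 ^ 8 * 9 := by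
    have h4 : (4 : ℝ) ^ (k + 4) ≤ 4 ^ 8 := pow_le_pow_right₀ (by norm_num) (by omega)
    nlinarith [mul_le_mul h4 hSk hSk0 (by positivity)]
  have hbr0 : 0 ≤ (1 + (4 : ℝ) ^ (k + 4) * ∑' q : Site 2, ((1 + ‖q‖) ^ (k + 4))⁻¹) := by positivity
  have hAoff : ∀ i ≤ 6, Aoff i ≤ CB := by
    intro i hi
    simp only [Aoff, hCB, hmax128, h2e]
    have h1 := hfac (k + 4) 8 (by omega)
    have h2 := hTle (i + (k + 4)) (by omega)
    have h3 := hfac (i + (k + 4) + 1) 15 (by omega)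
    have h4 := hp2 (i + 2) 8 (by omega)
    have h5 : (128 : ℝ) ^ (k + 4 - 1) ≤ 128 ^ 7 := pow_le_pow_right₀ (by norm_num) (by omega)
    have h6 : (8 : ℝ) ^ (k + 4) ≤ 8 ^ 8 := pow_le_pow_right₀ (by norm_num) (by omega)
    have := hT0 (i + (k + 4))
    have hTpos : 0 ≤ T := by rw [hT]; norm_num
    have hgoal : ((k + 4) ! : ℝ) * klChi2CauchyTab (i + (k + 4)) * ((i + (k + 4) + 1) ! : ℝ) * 2 ^ (i + 2) * 64 * 128 ^ (k + 4 - 1) * 8 ^ (k + 4) *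
          (1 + (4 : ℝ) ^ (k + 4) * ∑' q : Site 2, ((1 + ‖q‖) ^ (k + 4))⁻¹) ≤
        ((8 ! : ℕ) : ℝ) * T * ((15 ! : ℕ) : ℝ) * 2 ^ 8 * 64 * 128 ^ 7 * 8 ^ 8 * (1 + 4 ^ 8 * 9) := by
      gcongr
    exact hgoal
  have hAoff0 : ∀ i, 0 ≤ Aoff i := fun i => by simp only [Aoff]; have := hT0 (i + (k + 4)); positivity
  have hGoff : Goff ≤ CG := by
    simp only [Goff, hCG, hmax128, h2e]
    have := hT0 (k + 4)
    have h5 : (128 : ℝ) ^ (k + 4 - 1) ≤ 128 ^ 7 := pow_le_pow_right₀ (by norm_num) (by omega)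
    have h6 : (8 : ℝ) ^ (k + 4) ≤ 8 ^ 8 := pow_le_pow_right₀ (by norm_num) (by omega)
    have h2 := hTle (k + 4) (by omega)
    gcongr <;> omega
  have hGoff0 : 0 ≤ Goff := by simp only [Goff]; have := hT0 (k + 4); positivity
  -- the edge sums: each term `≤ 768·C`, at most 6 terms, `1/π ≤ 1`
  have hπ1 : 1 ≤ π := le_of_lt (lt_trans (by norm_num) Real.pi_gt_three)
  have hterm : ∀ (A : ℕ → ℝ) (C : ℝ), (∀ i, 0 ≤ A i) → (∀ i ≤ 6, A i ≤ C) → ∀ i ∈ Finset.range (k + 2),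
      2 * ((max i 1 : ℕ) : ℝ) * 2 ^ i * A i / π ≤ 768 * C := by
    intro A C hA0 hAC i hi
    rw [Finset.mem_range] at hi
    have hi6 : i ≤ 6 := by omega
    have hm : ((max i 1 : ℕ) : ℝ) ≤ 6 := by exact_mod_cast (show max i 1 ≤ 6 by omega)
    have hpi : (2 : ℝ) ^ i ≤ 2 ^ 6 := hp2 i 6 hi6
    have hC0 : 0 ≤ C := (hA0 0).trans (hAC 0 (by omega))
    calc 2 * ((max i 1 : ℕ) : ℝ) * 2 ^ i * A i / π ≤ 2 * ((max i 1 : ℕ) : ℝ) * 2 ^ i * A i :=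
          div_le_self (by have := hA0 i; positivity) hπ1
      _ ≤ 2 * 6 * 2 ^ 6 * C := by
          have := hA0 i
          exact mul_le_mul (mul_le_mul (by linarith) hpi (by positivity) (by positivity)) (hAC i hi6) this (by positivity)
      _ = 768 * C := by norm_num
  have hsum6 : ∀ (A : ℕ → ℝ) (C : ℝ), (∀ i, 0 ≤ A i) → (∀ i ≤ 6, A i ≤ C) →
      ∑ i ∈ Finset.range (k + 2), 2 * ((max i 1 : ℕ) : ℝ) * 2 ^ i * A i / π ≤ 6 * (768 * C) := by
    intro A C hA0 hAC
    have hC0 : 0 ≤ C := (hA0 0).trans (hAC 0 (by omega))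
    calc ∑ i ∈ Finset.range (k + 2), 2 * ((max i 1 : ℕ) : ℝ) * 2 ^ i * A i / π ≤ ∑ _i ∈ Finset.range (k + 2), 768 * C :=
          Finset.sum_le_sum (hterm A C hA0 hAC)
      _ = (k + 2 : ℕ) * (768 * C) := by rw [Finset.sum_const, Finset.card_range, nsmul_eq_mul]
      _ ≤ 6 * (768 * C) := mul_le_mul_of_nonneg_right hk6 (by positivity)
  have hEDon : EDon ≤ 6 * (768 * CA) := hsum6 Aon CA hAon0 hAon
  have hEDoff : EDoff ≤ 6 * (768 * CB) := hsum6 Aoff CB hAoff0 hAoff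
  have hEDoff0 : 0 ≤ EDoff := Finset.sum_nonneg fun i _ => by have := hAoff0 i; positivity
  -- the bulk terms and the maxima (ℓ = 1)
  have hCA0 : 0 ≤ CA := (hAon0 0).trans (hAon 0 (by omega))
  have hCB0 : 0 ≤ CB := (hAoff0 0).trans (hAoff 0 (by omega))
  have hBKon : ((k + 2 : ℕ) : ℝ) * Aon (k + 2) * (π / klE0) ^ (k + 2) / (1 : ℝ) ^ (k + 2) ≤ 6 * CA * 101 ^ 6 := by
    rw [one_pow, div_one]
    have := hAon0 (k + 2)
    exact mul_le_mul (mul_le_mul hk6 (hAon (k + 2) (by omega)) this (by norm_num)) hπpow (by positivity) (by positivity)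
  have hBKoff : ((k + 2 : ℕ) : ℝ) * Aoff (k + 2) * (π / klE0) ^ (k + 2) / (1 : ℝ) ^ (k + 2) ≤ 6 * CB * 101 ^ 6 := by
    rw [one_pow, div_one]
    have := hAoff0 (k + 2)
    exact mul_le_mul (mul_le_mul hk6 (hAoff (k + 2) (by omega)) this (by norm_num)) hπpow (by positivity) (by positivity)
  have hGon' : Gon' ≤ (16 + 6 * CA * 101 ^ 6) * 64 := by
    simp only [Gon']
    refine mul_le_mul ((max_le_add_of_nonneg (by norm_num) ?_).trans (add_le_add le_rfl hBKon)) h2k (by positivity) (by positivity)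
    rw [one_pow, div_one]; have := hAon0 (k + 2); positivity
  have hGoff' : Goff' ≤ (CG + 6 * CB * 101 ^ 6) * 64 := by
    simp only [Goff']
    refine mul_le_mul ((max_le_add_of_nonneg hGoff0 ?_).trans (add_le_add hGoff hBKoff)) h2k (by positivity) ?_
    · rw [one_pow, div_one]; have := hAoff0 (k + 2); positivity
    · have := hT0 (k + 4); rw [hCG, hT]; positivity
  have hGon'0 : 0 ≤ Gon' := mul_nonneg (le_max_of_le_left (by norm_num)) (pow_nonneg (by norm_num) _)
  have hGoff'0 : 0 ≤ Goff' := mul_nonneg (le_max_of_le_left hGoff0) (pow_nonneg (by norm_num) _)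
  have hS4 := hS 4 le_rfl
  have hS40 := hS0 4
  -- assemble
  have h1 : EDoff * ∑' z : Site 2, ((1 + ‖z‖) ^ 4)⁻¹ ≤ 6 * (768 * CB) * 9 := mul_le_mul hEDoff hS4 hS40 (by positivity)
  have h2 : Goff' * ∑' z : Site 2, ((1 + ‖z‖) ^ 4)⁻¹ ≤ (CG + 6 * CB * 101 ^ 6) * 64 * 9 :=
    mul_le_mul hGoff' hS4 hS40 (by have := hT0 (k + 4); rw [hCG, hT]; positivity)
  have hnum : 6 * (768 * CA) + 6 * (768 * CB) * 9 + 2 * (1 + (1 : ℝ)) * ((16 + 6 * CA * 101 ^ 6) * 64 + (CG + 6 * CB * 101 ^ 6) * 64 * 9) ≤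
      (10 : ℝ) ^ 95 := by
    rw [hCA, hCB, hCG, hT]
    norm_num [Nat.factorial]
  have hle : (EDon + EDoff * ∑' z : Site 2, ((1 + ‖z‖) ^ 4)⁻¹) + 2 * (1 + (1 : ℝ)) * (Gon' + Goff' * ∑' z : Site 2, ((1 + ‖z‖) ^ 4)⁻¹) ≤
      6 * (768 * CA) + 6 * (768 * CB) * 9 + 2 * (1 + (1 : ℝ)) * ((16 + 6 * CA * 101 ^ 6) * 64 + (CG + 6 * CB * 101 ^ 6) * 64 * 9) :=
    add_le_add (add_le_add hEDon h1) (mul_le_mul_of_nonneg_left (add_le_add hGon' h2) (by norm_num))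
  exact hle.trans hnum

/-- **`hrow` WITH THE NUMERAL `a = 10⁹⁵`** under the engine's binders (`μ ∈ klWindowC`, `klBetaMin ≤ β`, `klEngL₃ β U ≤ L`, `klEngM₃ β U L ≤ M`), `k ≤ 4`,
`0 ≤ λ ≤ 1` (decay-length knob `ℓ = 1`). -/
theorem rowSum_scaleZero_weighted_le_numeral {μ : ℝ} (hμ : μ ∈ klWindowC) {β U : ℝ} (hβ : klBetaMin ≤ β) (hL : klEngL₃ β U ≤ L)
    (hM : EngineV8.klEngM₃ β U L ≤ M) {k : ℕ} (hk : k ≤ 4) {lam : ℝ} (hlam0 : 0 ≤ lam) (hlam1 : lam ≤ 1) (X : GridLeg (GridPoint L (2 * (2 * M)))) :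
    ∑ Y : GridLeg (GridPoint L (2 * (2 * M))),
        ‖((hubbardGridSub L M β (2 * (2 * M))).transpose * hubbardCovAboveCT L M β μ 0 0 klE0 * hubbardGridSub L M β (2 * (2 * M))) X Y‖ *
          diamWeight (fun s => (1 + lam * s) ^ k) (gridLabelDist L (2 * (2 * M)) β) {gridLegPos X, gridLegPos Y} ≤
      (10 : ℝ) ^ 95 * ((2 * (2 * M) : ℕ) : ℝ) / β := by
  have hβ0 : 0 < β := lt_of_lt_of_le (by norm_num [klBetaMin]) hβ
  have h := rowSum_scaleZero_weighted_le_klEng (L := L) (M := M) hμ hβ hL hM hk one_pos hlam0 hlam1 (by rw [mul_one]; exact hlam1) X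
  dsimp only at h
  refine h.trans (div_le_div_of_nonneg_right (mul_le_mul_of_nonneg_right ?_ (by positivity)) hβ0.le)
  exact weightedSize_le_numeral hk

/-- **`hcol` WITH THE NUMERAL `a = 10⁹⁵`.** -/
theorem colSum_scaleZero_weighted_le_numeral {μ : ℝ} (hμ : μ ∈ klWindowC) {β U : ℝ} (hβ : klBetaMin ≤ β) (hL : klEngL₃ β U ≤ L)
    (hM : EngineV8.klEngM₃ β U L ≤ M) {k : ℕ} (hk : k ≤ 4) {lam : ℝ} (hlam0 : 0 ≤ lam) (hlam1 : lam ≤ 1) (Y : GridLeg (GridPoint L (2 * (2 * M)))) :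
    ∑ X : GridLeg (GridPoint L (2 * (2 * M))),
        ‖((hubbardGridSub L M β (2 * (2 * M))).transpose * hubbardCovAboveCT L M β μ 0 0 klE0 * hubbardGridSub L M β (2 * (2 * M))) X Y‖ *
          diamWeight (fun s => (1 + lam * s) ^ k) (gridLabelDist L (2 * (2 * M)) β) {gridLegPos X, gridLegPos Y} ≤
      (10 : ℝ) ^ 95 * ((2 * (2 * M) : ℕ) : ℝ) / β := by
  have hβ0 : 0 < β := lt_of_lt_of_le (by norm_num [klBetaMin]) hβ
  have h := colSum_scaleZero_weighted_le_klEng (L := L) (M := M) hμ hβ hL hM hk one_pos hlam0 hlam1 (by rw [mul_one]; exact hlam1) Y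
  dsimp only at h
  refine h.trans (div_le_div_of_nonneg_right (mul_le_mul_of_nonneg_right ?_ (by positivity)) hβ0.le)
  exact weightedSize_le_numeral hk

end Summit.HubbardSuperconductivity.HubbardSuperconductivity.Theorems.KLRegimeSplit

end
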